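import Summits.QuantumFields.BalabanUV.Beta.GAN24.FaceDataVHChart
import Summits.QuantumFields.BalabanUV.Beta.GAN24.FaceDataHessNull

/-!
# `BalabanUV.Beta.GAN24.FaceDataVHNull` — binder row G-an2-4, crossed-ledger telescopy (γ) hand, letter K7-a (VH half): **an1's ROOTED BORDER LETTER `vhSAt`
# VANISHES AGAINST TWO FACE-SUPPORTED SINGLE-COORDINATE DATA** (`Θ ≡ 0`), every free leg, every `d`, every in-block root — the composition of
`GAN24.FaceDataVHChart` (product chart = additive chart against such data) and `GAN24.FaceDataHessNull` (the additive-chart letter vanishes).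

NOT IN PRINT; OUR BOOKKEEPING ([folklore] two-line composition of this lineage's `FaceDataVHChart.vhSAt_faceData_eq_vhSaddAt(')` and
`FaceDataHessNull.vhSaddAt_faceData_eq_zero(')` over an1's `AveragingHessianKernelsRooted.vhSAt`; G-an2-4 formalisation swarm, leaf prover
`b2b-balaban-gan24-formalise-leaf-06`, gen 56).  HONEST FRAMING (cell contract): «discharging `BetaPertH` makes Bałaban's UV stability UNCONDITIONAL — a real
constructive-QFT result; it is NOT the continuum limit and NOT the Clay problem» (verbatim): «continuum YM on T⁴ ⇐ BetaPertH ∧ nine spine estimates (0/9 proved);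
BetaPertH ⇐ (D1) ∧ (D4) ∧ CAP+tail; G-an2-4 gates asym, D1 and NE2».

WHY.  The (γ) hand reads the E-frame forcing's crossed face∕cell words (`CrossedLedgerTelescope`'s `hface`, `hcell`); their E⊗VH and VH⊗E parts carry the factor
`Θ^{νβ}_m = Σ'_q h(q_β)·Σ'_u s(u_ν)·vhSAt ρ d L ν u q p (inl β) (inr m)` with both data supported on the exit faces `n ≡ −1 (mod L)` (coarse-period face indicators,
`L ∣ N`).  This file records `Θ = 0` as ONE citable statement: the face∕cell words of the forcing are PURE E⊗E (the typed E⊗E values: `FaceWordEECellOne`,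
`FaceWordCurrentsDeep`, …).  ENGINE cross-check (weight 0): `|Θ| ≤ 3·10⁻¹⁵` in D = 2 and D = 3 (this lineage's gen-56 kits j222823, j224036).

WHAT ([folklore]; generic `d`, `1 ≤ L`, in-block root `r ∈ box L`; 0 def, 0 cited facts, 0 sorry): **`vhSAt_faceData_eq_zero`** (weighted leg first, free leg second)
and **`vhSAt_faceData_eq_zero'`** (free leg first).  Asserts NO value of Bałaban's tables beyond an1's DEFINED kernels; NOT (VAL-l), NOT «hXu», NOT D1, NOT
`BetaPertH`, NOT continuum, NOT Clay.
-/

noncomputable section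

open scoped BigOperators
open Literature.MathematicalPhysics.QuantumFieldTheory.Balaban1983to89
open Literature.MathematicalPhysics.QuantumFieldTheory.Balaban1983to89.Beta
open AffineAveraging AveragingHessianKernelsRooted
open OneStepResolventKernel (Fib)
open Summit.QuantumFields.BalabanUV.Beta.GAN24.FaceDataVHChart (vhSAt_faceData_eq_vhSaddAt vhSAt_faceData_eq_vhSaddAt')
open Summit.QuantumFields.BalabanUV.Beta.GAN24.FaceDataHessNull (vhSaddAt_faceData_eq_zero vhSaddAt_faceData_eq_zero')

namespace Summit.QuantumFields.BalabanUV.Beta.GAN24.FaceDataVHNull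

variable {d : ℕ}

/-- [folklore] **THE ROOTED BORDER LETTER AGAINST FACE DATA ON BOTH LEGS VANISHES (weighted leg first, free leg second)**: for exit-face-supported
single-coordinate data `h` (direction `β`, field leg) and `s` (direction `ν`, slot leg), `1 ≤ L`, `r ∈ box L`, every free leg `(p, a)`:
`Σ'_q h(q_β)·Σ'_u s(u_ν)·vhSAt ρ d L ν u q p (inl β) a = 0`. -/
theorem vhSAt_faceData_eq_zero {L : ℕ} (hL : 1 ≤ L) {r : Fin (d + 1) → ℕ} (hr : r ∈ box (d + 1) L) (ν β : Fin (d + 1))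
    {h s : ℤ → ℝ} (hh : ∀ n : ℤ, n % (L : ℤ) ≠ (L : ℤ) - 1 → h n = 0) (hs : ∀ n : ℤ, n % (L : ℤ) ≠ (L : ℤ) - 1 → s n = 0)
    (p : Site (d + 1)) (a : Fib d) :
    ∑' q : Site (d + 1), h (q β) * ∑' u : Site (d + 1), s (u ν) * vhSAt (toSite r) d L rfl ν u q p (Sum.inl β) a = 0 := by
  rw [vhSAt_faceData_eq_vhSaddAt hL hr ν β hh hs p a]
  exact vhSaddAt_faceData_eq_zero hL hr ν β hh hs p a

/-- [folklore] **THE ROOTED BORDER LETTER AGAINST FACE DATA ON BOTH LEGS VANISHES (free leg first, weighted leg second).** -/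
theorem vhSAt_faceData_eq_zero' {L : ℕ} (hL : 1 ≤ L) {r : Fin (d + 1) → ℕ} (hr : r ∈ box (d + 1) L) (ν β : Fin (d + 1))
    {h s : ℤ → ℝ} (hh : ∀ n : ℤ, n % (L : ℤ) ≠ (L : ℤ) - 1 → h n = 0) (hs : ∀ n : ℤ, n % (L : ℤ) ≠ (L : ℤ) - 1 → s n = 0)
    (p : Site (d + 1)) (a : Fib d) :
    ∑' q : Site (d + 1), h (q β) * ∑' u : Site (d + 1), s (u ν) * vhSAt (toSite r) d L rfl ν u p q a (Sum.inl β) = 0 := by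
  rw [vhSAt_faceData_eq_vhSaddAt' hL hr ν β hh hs p a]
  exact vhSaddAt_faceData_eq_zero' hL hr ν β hh hs p a

end Summit.QuantumFields.BalabanUV.Beta.GAN24.FaceDataVHNull

end
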